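import Summits.NavierStokesRegularity.NavierStokesRegularity.Theses.AdaptedFrequency
import Literature.Analysis.FluidPDE.AdaptedBackwardKernel
import Literature.Analysis.UnboundedOperators.HeatKernelGradient

/-!
# `FrequencyRigidity` (crux `stmt-NavierStokesRegularity-2955`, route `AdaptedFrequency`):
# clause bundles, variants, witnesses, the model kernel, and (A) positivity of `H` is load-bearing
# — negative-side support (refuter, cdisprove), file 1 of 3

`AdaptedFrequency.FrequencyRigidity = ¬ ∃ (ν C Λ₀ v q K), …`: no smooth ancient Navier–Stokes
flow on `ℝ³ × (−∞,0)` with the GLOBAL Type-I bound `‖v(t,x)‖ ≤ C/√(−t)`, an adapted two-sided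
Gaussian-comparable kernel `K` at `(0,0)`, positive adapted enstrophy `H` and constant adapted
frequency `Λ ≡ Λ₀`.  No `¬`-theorem of the crux is claimed (a witness would contain a non-trivial
bounded mild ancient solution with Type-I decay at both ends — open, excluded by the KNSS
Liouville conjecture; see the crux work-file `Cruxes/FrequencyRigidity/Disproof.lean`).  These
files prove WHICH hypotheses any proof must use, each by an explicit witness whose adapted kernel
is the backward heat kernel (it is adapted to every flow tangent to the spheres about the pole).

This file:
* `TypeIBound`, `KernelClauses`, `Comparable`, `FreqClause`, `FreqClauseNoPos` and
  `frequencyRigidity_iff` — the crux regrouped into named clause bundles (bookkeeping only).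
* `kernelClauses_backwardHeatKernel`, `comparable_backwardHeatKernel` — the backward heat kernel
  at `(0,0)` satisfies the five kernel clauses for EVERY drift tangent to the spheres about `0`
  (`⟪x, v(t,x)⟫ = 0`), and the comparability clause.
* (A) `FrequencyRigidityWithoutPosH`, `frequencyRigidity_of_withoutPosH`,
  `frequencyRigidity_false_without_posH` — dropping `0 < H t` makes the crux FALSE (zero flow,
  `Λ₀ = 0`): any proof must use positivity of the adapted enstrophy.
* the OBJECTS and VARIANTS of the companion files (all definitions live here): `e₃`, `rot`
  (rigid rotation `e₃ × ·`), `LocalTypeIBound`, `FrequencyRigidityWithoutTypeI`,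
  `FrequencyRigidityLocalTypeI`; the radial cutoff `χ`, profile `V = χ · rot`, similarity factor
  `sc t = 1/√(−t)`, the self-similar witness `swirl`, its profile enstrophy density `F`, and
  `FrequencyRigidityWithoutMomentum`.
Companions (theorems only): `Negative/RigidRotation.lean` — (B) the GLOBAL Type-I bound is
load-bearing (`frequencyRigidity_false_with_local_typeI`, `frequencyRigidity_false_without_typeI`);
`Negative/SelfSimilarSwirl.lean` — (C) the momentum equation is load-bearing, `Λ₀ = 2` realised
(`frequencyRigidity_false_without_momentum`).

## References

* G. Koch, N. Nadirashvili, G. Seregin, V. Šverák, *Liouville theorems for the Navier–Stokes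
  equations and applications*, Acta Math. 203 (2009) 83–105. [KochNadirashviliSereginSverak2009]
* T.-P. Tsai, *On Leray's self-similar solutions of the Navier–Stokes equations satisfying local
  energy estimates*, Arch. Ration. Mech. Anal. 143 (1998) 29–51. [Tsai1998]
* C.-C. Poon, *Unique continuation for parabolic equations*, Comm. PDE 21 (1996) 521–539. [Poon1996]
-/

noncomputable section

set_option linter.dupNamespace false

namespace Summit.NavierStokesRegularity.NavierStokesRegularity.Theorems.FrequencyRigidity.Negative

open Literature.Analysis.FluidPDE Literature.Analysis.UnboundedOperators
open MeasureTheory Set Filter Topology Function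
open scoped Laplacian InnerProductSpace RealInnerProductSpace ContDiff

/-- Physical space `ℝ³`. -/
abbrev E3 := EuclideanSpace ℝ (Fin 3)

/-! ### The crux, regrouped into named clause bundles -/

/-- Global Type-I bound `‖v(t,x)‖ ≤ C/√(−t)` on `ℝ³ × (−∞,0)` (verbatim clause of the crux). -/
def TypeIBound (C : ℝ) (v : ℝ → E3 → E3) : Prop :=
  ∀ t ∈ Iio (0:ℝ), ∀ x, ‖v t x‖ ≤ C / Real.sqrt (-t)

/-- The five adapted-kernel clauses of the crux for the drift `v` (verbatim). -/
def KernelClauses (ν : ℝ) (v : ℝ → E3 → E3) (K : ℝ → E3 → ℝ) : Prop :=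
  ContDiffOn ℝ 2 (uncurry K) (Iio (0:ℝ) ×ˢ univ) ∧
  (∀ t ∈ Iio (0:ℝ), ∀ x, 0 < K t x) ∧
  (∀ t ∈ Iio (0:ℝ), ∀ x,
    timeDerivWithin (Iio (0:ℝ)) K t x + fderiv ℝ (K t) x (v t x) + ν * (Δ (K t)) x = 0) ∧
  (∀ t ∈ Iio (0:ℝ), ∫ x, K t x = 1) ∧
  (∀ φ : E3 → ℝ, Continuous φ → (∃ M : ℝ, ∀ x, |φ x| ≤ M) →
    Tendsto (fun t => ∫ x, φ x * K t x) (𝓝[Iio (0:ℝ)] (0:ℝ)) (𝓝 (φ (0 : E3))))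

/-- Two-sided Gaussian comparability about the pole `(0,0)` (verbatim clause of the crux). -/
def Comparable (K : ℝ → E3 → ℝ) : Prop :=
  ∃ c₁ c₂ C₁ C₂ : ℝ, 0 < c₁ ∧ 0 < c₂ ∧ 0 < C₁ ∧ 0 < C₂ ∧ ∀ t ∈ Iio (0:ℝ), ∀ x,
    c₁ * ((0:ℝ) - t) ^ (-(3:ℝ) / 2) * Real.exp (-(‖x - (0 : E3)‖ ^ 2) / (c₂ * ((0:ℝ) - t))) ≤
        K t x ∧
      K t x ≤ C₁ * ((0:ℝ) - t) ^ (-(3:ℝ) / 2) * Real.exp (-(‖x - (0 : E3)‖ ^ 2) / (C₂ * ((0:ℝ) - t)))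

/-- The frequency clause of the crux: positive adapted enstrophy AND constant adapted frequency
`Λ₀` (verbatim, with the `∀ H Λ, H = … → Λ = … →` binders). -/
def FreqClause (v : ℝ → E3 → E3) (K : ℝ → E3 → ℝ) (Λ₀ : ℝ) : Prop :=
  ∀ H Λ : ℝ → ℝ, H = (fun t => ∫ x, ‖curl (v t) x‖ ^ 2 * K t x) →
    Λ = (fun t => (0 - t) * deriv H t / H t) →
      (∀ t ∈ Iio (0:ℝ), 0 < H t) ∧ (∀ t ∈ Iio (0:ℝ), Λ t = Λ₀)

/-- The frequency clause WITHOUT positivity of `H` (only `Λ ≡ Λ₀`). -/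
def FreqClauseNoPos (v : ℝ → E3 → E3) (K : ℝ → E3 → ℝ) (Λ₀ : ℝ) : Prop :=
  ∀ H Λ : ℝ → ℝ, H = (fun t => ∫ x, ‖curl (v t) x‖ ^ 2 * K t x) →
    Λ = (fun t => (0 - t) * deriv H t / H t) → ∀ t ∈ Iio (0:ℝ), Λ t = Λ₀

/-- Bookkeeping: the crux is `¬ ∃` of the conjunction of the bundles above. -/
theorem frequencyRigidity_iff :
    Theses.AdaptedFrequency.FrequencyRigidity ↔
      ¬ ∃ (ν C Λ₀ : ℝ) (v : ℝ → E3 → E3) (q : ℝ → E3 → ℝ) (K : ℝ → E3 → ℝ), 0 < ν ∧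
        IsClassicalNSSolutionOn (Iio 0) ν 0 v q ∧ TypeIBound C v ∧ KernelClauses ν v K ∧
        Comparable K ∧ FreqClause v K Λ₀ := by
  simp only [Theses.AdaptedFrequency.FrequencyRigidity, TypeIBound, KernelClauses, Comparable,
    FreqClause, and_assoc]

/-! ### The model kernel: the backward heat kernel at the pole `(0,0)` -/

/-- The backward heat kernel with pole `(0,0)`, as a function of `x` (the shift by `0` removed). -/
theorem backwardHeatKernel_zero_eq (ν t : ℝ) :
    backwardHeatKernel ν 0 (0 : E3) t = heatKernel (ν * (0 - t)) := by
  funext x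
  simp [backwardHeatKernel]

/-- Gradient of the model kernel along a vector: `DK(t)(x) h = −(K/(2ν(−t))) ⟪x, h⟫`. -/
theorem fderiv_backwardHeatKernel_apply (ν t : ℝ) (x h : E3) :
    fderiv ℝ (backwardHeatKernel ν 0 (0 : E3) t) x h =
      -(heatKernel (ν * (0 - t)) x / (2 * (ν * (0 - t)))) * ⟪x, h⟫ := by
  rw [backwardHeatKernel_zero_eq, (hasFDerivAt_heatKernel (ν * (0 - t)) x).fderiv]
  simp

/-- **The heat kernel is adapted to every flow tangent to the spheres about the pole.**  If
`⟪x, v(t,x)⟫ = 0` for all `t < 0` and `x`, then the backward heat kernel at `(0,0)` satisfies the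
five kernel clauses of the crux for the drift `v` (the transport term `DK·v` vanishes because
`∇K ∥ x`). -/
theorem kernelClauses_backwardHeatKernel {ν : ℝ} (hν : 0 < ν) (v : ℝ → E3 → E3)
    (hv : ∀ t ∈ Iio (0:ℝ), ∀ x, ⟪x, v t x⟫ = 0) :
    KernelClauses ν v (backwardHeatKernel ν 0 (0 : E3)) := by
  have hK := isAdaptedBackwardKernel_backwardHeatKernel (E := E3) hν 0 0
  refine ⟨hK.contDiffOn, hK.pos, ?_, hK.integral_eq_one, hK.tendsto_integral_mul⟩
  intro t ht x
  have h0 := hK.adjoint_eq t ht x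
  simp only [Pi.zero_apply, map_zero, add_zero] at h0
  rw [fderiv_backwardHeatKernel_apply, hv t ht x, mul_zero, add_zero]
  exact h0

/-- The model kernel is two-sided Gaussian-comparable (with equality constants). -/
theorem comparable_backwardHeatKernel {ν : ℝ} (hν : 0 < ν) :
    Comparable (backwardHeatKernel ν 0 (0 : E3)) :=
  isGaussianComparable_iff_fin_three.1 (isGaussianComparable_backwardHeatKernel hν 0 0)

/-! ### Vector-calculus helpers -/

/-- The Laplacian of a continuous linear map vanishes. -/
theorem laplacian_clm (f : E3 →L[ℝ] E3) (x : E3) : (Δ (⇑f)) x = 0 := by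
  rw [InnerProductSpace.laplacian_eq_iteratedFDeriv_stdOrthonormalBasis]
  simp only [iteratedFDeriv_two_apply]
  have : fderiv ℝ (⇑f) = fun _ => f := funext fun _ => ContinuousLinearMap.fderiv f
  simp [this]

/-- The Laplacian of the zero field vanishes. -/
theorem laplacian_zero_fun (x : E3) : (Δ (fun _ : E3 => (0 : E3))) x = 0 := by
  rw [InnerProductSpace.laplacian_eq_iteratedFDeriv_stdOrthonormalBasis]
  simp

/-- The curl of a constant field vanishes. -/
theorem curl_const (c x : E3) : curl (fun _ => c) x = 0 := by
  simp [curl]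

/-! ### (A) Positivity of the adapted enstrophy is load-bearing -/

/-- The crux with the clause `∀ t < 0, 0 < H t` DROPPED (everything else verbatim). -/
def FrequencyRigidityWithoutPosH : Prop :=
  ¬ ∃ (ν C Λ₀ : ℝ) (v : ℝ → E3 → E3) (q : ℝ → E3 → ℝ) (K : ℝ → E3 → ℝ), 0 < ν ∧
    IsClassicalNSSolutionOn (Iio 0) ν 0 v q ∧ TypeIBound C v ∧ KernelClauses ν v K ∧
    Comparable K ∧ FreqClauseNoPos v K Λ₀

/-- The variant is a strengthening of the crux (fewer hypotheses under `¬ ∃`). -/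
theorem frequencyRigidity_of_withoutPosH (h : FrequencyRigidityWithoutPosH) :
    Theses.AdaptedFrequency.FrequencyRigidity := by
  rw [frequencyRigidity_iff]
  rintro ⟨ν, C, Λ₀, v, q, K, hν, hNS, hTI, hK, hC, hF⟩
  exact h ⟨ν, C, Λ₀, v, q, K, hν, hNS, hTI, hK, hC, fun H Λ hH hΛ => (hF H Λ hH hΛ).2⟩

/-- The zero flow is a classical NS solution on any time set. -/
theorem isClassicalNSSolutionOn_zero (S : Set ℝ) (ν : ℝ) :
    IsClassicalNSSolutionOn S ν (0 : ℝ → E3 → E3) (fun _ _ => (0 : E3)) (fun _ _ => (0 : ℝ)) where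
  smooth_velocity := contDiffOn_const
  smooth_pressure := contDiffOn_const
  momentum t ht x := by
    simp [timeDerivWithin_apply, convect_apply, laplacian_zero_fun]
  divFree t ht x := by
    simp [VectorCalculus.divergence]

/-- **(A)** Dropping `0 < H t` makes the crux FALSE: witness `ν = 1`, `C = 0`, `Λ₀ = 0`,
`v ≡ 0`, `q ≡ 0`, `K` = backward heat kernel at `(0,0)`; then `H ≡ 0`, `Λ ≡ 0/0 = 0`. -/
theorem frequencyRigidity_false_without_posH : ¬ FrequencyRigidityWithoutPosH := by
  intro h
  refine h ⟨1, 0, 0, fun _ _ => 0, fun _ _ => 0, backwardHeatKernel 1 0 (0 : E3), one_pos,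
    isClassicalNSSolutionOn_zero _ _, ?_, ?_, comparable_backwardHeatKernel one_pos, ?_⟩
  · intro t ht x; simp
  · exact kernelClauses_backwardHeatKernel one_pos _ (fun t ht x => by simp)
  · intro H Λ hH hΛ t ht
    have hH0 : H t = 0 := by rw [hH]; simp
    rw [hΛ]; simp [hH0]


/-! ### Objects and variants used by the companion files `RigidRotation`, `SelfSimilarSwirl` -/

/-- `e₃ = (0,0,1)`. -/
def e₃ : E3 := EuclideanSpace.single 2 1

/-- The generator of rigid rotation about the `x₃`-axis, `rot x = e₃ × x = (−x₂, x₁, 0)`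
(the tree's bilinear `crossCLM`). -/
def rot : E3 →L[ℝ] E3 := crossCLM e₃

/-- Type-I bound only on the unit backward parabolic cylinder `Q₁(0,0) = (−1,0) × B̄₁(0)` —
the LOCAL form natural at a backward-singular point. -/
def LocalTypeIBound (C : ℝ) (v : ℝ → E3 → E3) : Prop :=
  ∀ t ∈ Ioo (-1:ℝ) 0, ∀ x : E3, ‖x‖ ≤ 1 → ‖v t x‖ ≤ C / Real.sqrt (-t)

/-- The crux with the Type-I clause DROPPED. -/
def FrequencyRigidityWithoutTypeI : Prop :=
  ¬ ∃ (ν Λ₀ : ℝ) (v : ℝ → E3 → E3) (q : ℝ → E3 → ℝ) (K : ℝ → E3 → ℝ), 0 < ν ∧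
    IsClassicalNSSolutionOn (Iio 0) ν 0 v q ∧ KernelClauses ν v K ∧ Comparable K ∧
    FreqClause v K Λ₀

/-- The crux with the GLOBAL Type-I clause replaced by the LOCAL one on `Q₁(0,0)`. -/
def FrequencyRigidityLocalTypeI : Prop :=
  ¬ ∃ (ν C Λ₀ : ℝ) (v : ℝ → E3 → E3) (q : ℝ → E3 → ℝ) (K : ℝ → E3 → ℝ), 0 < ν ∧
    IsClassicalNSSolutionOn (Iio 0) ν 0 v q ∧ LocalTypeIBound C v ∧ KernelClauses ν v K ∧
    Comparable K ∧ FreqClause v K Λ₀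

/-- Radial cutoff `χ y = smoothTransition (2 − ‖y‖²)`: smooth, `= 1` on `‖y‖ ≤ 1`,
`= 0` on `‖y‖² ≥ 2`, values in `[0,1]`. -/
def χ (y : E3) : ℝ := Real.smoothTransition (2 - ‖y‖ ^ 2)

/-- The profile `V y = χ(y) · (e₃ × y)`: smooth, compactly supported, divergence-free,
tangent to the spheres about `0`, and equal to `rot` on the unit ball. -/
def V (y : E3) : E3 := χ y • rot y

/-- Similarity factor `sc t = 1/√(−t)`. -/
def sc (t : ℝ) : ℝ := (Real.sqrt (-t))⁻¹

/-- **The witness field**: `swirl t x = sc(t) V(sc(t) x)`, i.e. the backward self-similar field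
with profile `V`; for `‖x‖ ≤ √(−t)` it is `(−t)⁻¹ e₃ × x`. -/
def swirl (t : ℝ) (x : E3) : E3 := sc t • V (sc t • x)

/-- The (time-independent) similarity-profile enstrophy density. -/
def F (ν : ℝ) (y : E3) : ℝ := ‖curl V y‖ ^ 2 * heatKernel ν y

/-- The crux with the MOMENTUM EQUATION dropped: `v` is only required to be jointly smooth on
`(−∞,0) × ℝ³` and divergence-free (no pressure, no dynamics); everything else verbatim. -/
def FrequencyRigidityWithoutMomentum : Prop :=
  ¬ ∃ (ν C Λ₀ : ℝ) (v : ℝ → E3 → E3) (K : ℝ → E3 → ℝ), 0 < ν ∧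
    IsSmoothSpaceTimeOn (Iio 0) v ∧ (∀ t ∈ Iio (0:ℝ), VectorCalculus.IsDivFree (v t)) ∧
    TypeIBound C v ∧ KernelClauses ν v K ∧ Comparable K ∧ FreqClause v K Λ₀

end Summit.NavierStokesRegularity.NavierStokesRegularity.Theorems.FrequencyRigidity.Negative
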